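import Literature.NumberTheory.Transcendental.SixExponentialsSeveralVariablesAuxiliary
import HarnessLib

/-!
# The five exponentials theorem, direct proof — II: the auxiliary function

Topic `Literature/NumberTheory/Transcendental`; sibling proof file of `FiveExponentials.lean`
(the named fact `waldschmidt1988_fiveExponentials`, [Waldschmidt1988, §2 c) Corollary 2.2]) and
of `FiveExponentialsZeroEstimate.lean` (part I, whose module docstring describes the whole route).
Everything here is PROVED; there are no new definitions and no new facts.

This is the analytic half of "§6, Proposition 6.1" of [Waldschmidt1988] in the configuration of
Corollary 2.2. The source constructs its auxiliary polynomial by [15, Prop. 2.4] (Thue–Siegel with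
vanishing conditions and a Schwarz lemma); we use instead Waldschmidt's interpolation-free
"fonction auxiliaire générale" of [Waldschmidt1981, §3] — already formalised in the tree for the
toric case (`SixExponentialsSeveralVariablesAuxiliary.lean`: `box_principle_complex`,
`norm_exp_sub_partialSum_le`, …) — which makes the function SMALL on a whole polydisc, the
vanishing at the points of `Γ(3S)` with multiplicity along `W` being recovered afterwards from
Cauchy's inequalities and Liouville's inequality (part III, `FiveExponentialsLiouville.lean`).

Concretely, in the coordinates `(s, w)` of `V = {λu₀ + λu₁ = γu₂}` for which
`exp_G ∘ Φ(s, w) = (w; e^{s-w}, e^{κs})`, `κ = λ/γ`, `W = Φ(0 × ℂ)`, the function attached to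
integers `p(a, b, c)` (`0 ≤ a < D₀`, `0 ≤ b, c < D₁`) is
`F(s, w) = ∑ p(a,b,c) w^a e^{-bw} e^{(b + cκ)s} = P(w, e^{s-w}, e^{κs})`,
`P = ∑ p(a,b,c) X₀^a X₁^b X₂^c`. We prove (`exists_smallValues`): if `R ≥ 1`, `D₁(1 + |κ|)R ≤ ρ`,
`8ρ ≤ T₀` and `k^{2T₀(T₀+D₀)} < (P_b+1)^{D₀D₁²}`, there are integers `p`, not all zero,
`|p| ≤ P_b`, with
`|F(s,w)| ≤ T₀(T₀+D₀) · 2(2D₀D₁² R^{D₀}e^{2ρ} P_b + 1)/k + D₀D₁² P_b R^{D₀} · 4e^{ρ}e^{-T₀}`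
for `|s|, |w| ≤ R`. The `T₀(T₀ + D₀)` linear forms made small by the box principle are the Taylor
coefficients at the origin of the truncation `∑ p w^a E_{T₀}(-bw) E_{T₀}((b+cκ)s)`
(`E_T(x) = ∑_{k<T} x^k/k!`), grouped by the monomials `w^e s^i`, `e < T₀ + D₀`, `i < T₀`
(`main_identity`); grouping by `e = a + j` rather than by `(a, j)` is what keeps the number of
conditions at `T₀(T₀ + D₀) ≍ T₀²` instead of `T₀²D₀` (with `D₀ ≍ S²` this is the whole point:
the count `T₀² V ≲ D₀D₁² H` of part IV then closes exactly as in Proposition 6.1 with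
`D₀ ≍ S²`, `D₁ ≍ S log S`, `T₀, V, H ≍ S² log S`).

## References

* [Waldschmidt1988] M. Waldschmidt, *On the transcendence methods of Gel'fond and Schneider in
  several variables*, New Advances in Transcendence Theory (A. Baker ed.), CUP 1988, 375–398:
  §6 Proposition 6.1 (pp. 388–389); held scan `book:baker1988-new-advances-transcendence-theory`,
  pp. 310–311.
* [Waldschmidt1981] M. Waldschmidt, *Transcendance et exponentielles en plusieurs variables*,
  Invent. Math. 63 (1981) 97–127, §3 Théorème 3.1 (the interpolation-free auxiliary function).
-/

noncomputable section

open Complex Finset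

namespace Literature.NumberTheory.Transcendental.Waldschmidt1988

open Waldschmidt1981 (box_principle_complex norm_expPartialSum_le norm_exp_sub_partialSum_le)

/-! ### Reindexing and elementary bounds -/

/-- A sum over `Fin N` of a function supported at the value `n < N`. [folklore] -/
theorem sum_fin_ite_val_eq {N n : ℕ} (hn : n < N) (f : Fin N → ℂ) :
    ∑ e : Fin N, (if (e : ℕ) = n then f e else 0) = f ⟨n, hn⟩ := by
  rw [Finset.sum_eq_single ⟨n, hn⟩]
  · simp
  · intro b _ hb
    rw [if_neg]
    exact fun h => hb (Fin.ext h)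
  · intro h
    exact absurd (Finset.mem_univ _) h

/-- `‖x^i / i!‖ ≤ e^ρ` for `‖x‖ ≤ ρ`. [folklore] -/
theorem norm_pow_div_factorial_le_exp {x : ℂ} {ρ : ℝ} (hx : ‖x‖ ≤ ρ) (i : ℕ) :
    ‖x ^ i / (i.factorial : ℂ)‖ ≤ Real.exp ρ := by
  have hρ : 0 ≤ ρ := (norm_nonneg _).trans hx
  rw [norm_div, norm_pow, Complex.norm_natCast]
  exact (div_le_div_of_nonneg_right (pow_le_pow_left₀ (norm_nonneg _) hx _)
    (by positivity)).trans (Real.pow_div_factorial_le_exp ρ hρ _)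

/-- `∑_{j<T} ‖x^j / j!‖ ≤ e^ρ` for `‖x‖ ≤ ρ`. [folklore] -/
theorem sum_norm_pow_div_factorial_le_exp {x : ℂ} {ρ : ℝ} (hx : ‖x‖ ≤ ρ) (T : ℕ) :
    ∑ j : Fin T, ‖x ^ (j : ℕ) / ((j : ℕ).factorial : ℂ)‖ ≤ Real.exp ρ := by
  have h1 : ∑ j : Fin T, ‖x ^ (j : ℕ) / ((j : ℕ).factorial : ℂ)‖ =
      ∑ j ∈ range T, ‖x‖ ^ j / j.factorial := by
    rw [← Finset.sum_range fun j => ‖x ^ j / (j.factorial : ℂ)‖]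
    refine Finset.sum_congr rfl fun j _ => ?_
    rw [norm_div, norm_pow, Complex.norm_natCast]
  rw [h1]
  exact (Real.sum_le_exp_of_nonneg (norm_nonneg _) _).trans (Real.exp_le_exp.mpr hx)

/-! ### The truncated Taylor coefficients of `F(s, w) = ∑ p(a,b,c) w^a e^{-bw} e^{(b+cκ)s}`

Index of the unknowns: `l = (a, b, c) : Fin D₀ × Fin D₁ × Fin D₁`; frequency
`ν_l = b + cκ`; row index `r = (i, e) : Fin T₀ × Fin (T₀ + D₀)` (the monomial `w^e s^i`).
The matrix entry is
`M_{r,l} = ∑_{j<T₀} [e = a + j] · (-bR)^j/j! · (ν_l R)^i/i! · R^a`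
(at most one non-zero term), i.e. `R^{e+i}` times the coefficient `q_{r,l}` of `w^e s^i` in
`w^a E_{T₀}(-bw) E_{T₀}(ν_l s)`. No definition is introduced: the expressions are written out. -/

section Coefficients

variable {D₀ D₁ T₀ : ℕ}

/-- `M_{r,l} = q_{r,l} · R^{e+i}`. [folklore] -/
theorem entry_eq_coeff_mul_pow (κ : ℂ) (R : ℝ) (r : Fin T₀ × Fin (T₀ + D₀))
    (l : Fin D₀ × Fin D₁ × Fin D₁) :
    (∑ j : Fin T₀, if ((r.2 : ℕ) = (l.1 : ℕ) + (j : ℕ)) then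
        ((-(((l.2.1 : ℕ) : ℂ)) * R) ^ (j : ℕ) / ((j : ℕ).factorial : ℂ)) *
          (((((l.2.1 : ℕ) : ℂ) + ((l.2.2 : ℕ) : ℂ) * κ) * R) ^ (r.1 : ℕ) /
            ((r.1 : ℕ).factorial : ℂ)) * (R : ℂ) ^ (l.1 : ℕ) else 0) =
      (∑ j : Fin T₀, if ((r.2 : ℕ) = (l.1 : ℕ) + (j : ℕ)) then
        ((-(((l.2.1 : ℕ) : ℂ))) ^ (j : ℕ) / ((j : ℕ).factorial : ℂ)) *
          ((((l.2.1 : ℕ) : ℂ) + ((l.2.2 : ℕ) : ℂ) * κ) ^ (r.1 : ℕ) / ((r.1 : ℕ).factorial : ℂ))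
          else 0) * (R : ℂ) ^ ((r.2 : ℕ) + (r.1 : ℕ)) := by
  rw [Finset.sum_mul]
  refine Finset.sum_congr rfl fun j _ => ?_
  split_ifs with h
  · rw [h, pow_add, pow_add, mul_pow, mul_pow]
    ring
  · rw [zero_mul]

/-- The entry bound `‖M_{r,l}‖ ≤ R^{D₀} e^{2ρ}` (`R ≥ 1`, `bR ≤ ρ`, `|ν_l| R ≤ ρ`). [folklore] -/
theorem norm_entry_le (κ : ℂ) {R ρ : ℝ} (hR : 1 ≤ R) (r : Fin T₀ × Fin (T₀ + D₀))
    (l : Fin D₀ × Fin D₁ × Fin D₁) (hb : ((l.2.1 : ℕ) : ℝ) * R ≤ ρ)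
    (hν : ‖(((l.2.1 : ℕ) : ℂ) + ((l.2.2 : ℕ) : ℂ) * κ)‖ * R ≤ ρ) :
    ‖∑ j : Fin T₀, (if ((r.2 : ℕ) = (l.1 : ℕ) + (j : ℕ)) then
        ((-(((l.2.1 : ℕ) : ℂ)) * R) ^ (j : ℕ) / ((j : ℕ).factorial : ℂ)) *
          (((((l.2.1 : ℕ) : ℂ) + ((l.2.2 : ℕ) : ℂ) * κ) * R) ^ (r.1 : ℕ) /
            ((r.1 : ℕ).factorial : ℂ)) * (R : ℂ) ^ (l.1 : ℕ) else 0)‖ ≤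
      R ^ D₀ * Real.exp ρ ^ 2 := by
  have hR0 : 0 ≤ R := zero_le_one.trans hR
  set x : ℂ := (-(((l.2.1 : ℕ) : ℂ))) * R with hx
  set ν : ℂ := (((l.2.1 : ℕ) : ℂ) + ((l.2.2 : ℕ) : ℂ) * κ) with hνdef
  have hxρ : ‖x‖ ≤ ρ := by
    rw [hx, norm_mul, norm_neg, Complex.norm_natCast, Complex.norm_real, Real.norm_eq_abs,
      abs_of_nonneg hR0]
    exact hb
  have hνρ : ‖ν * R‖ ≤ ρ := by
    rw [norm_mul, Complex.norm_real, Real.norm_eq_abs, abs_of_nonneg hR0]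
    exact hν
  have hρ0 : 0 ≤ ρ := (norm_nonneg _).trans hxρ
  have hRa : ‖(R : ℂ) ^ (l.1 : ℕ)‖ ≤ R ^ D₀ := by
    rw [norm_pow, Complex.norm_real, Real.norm_eq_abs, abs_of_nonneg hR0]
    exact pow_le_pow_right₀ hR (l.1.isLt.le)
  calc ‖∑ j : Fin T₀, (if ((r.2 : ℕ) = (l.1 : ℕ) + (j : ℕ)) then
          (x ^ (j : ℕ) / ((j : ℕ).factorial : ℂ)) *
            ((ν * R) ^ (r.1 : ℕ) / ((r.1 : ℕ).factorial : ℂ)) * (R : ℂ) ^ (l.1 : ℕ) else 0)‖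
      ≤ ∑ j : Fin T₀, ‖(if ((r.2 : ℕ) = (l.1 : ℕ) + (j : ℕ)) then
          (x ^ (j : ℕ) / ((j : ℕ).factorial : ℂ)) *
            ((ν * R) ^ (r.1 : ℕ) / ((r.1 : ℕ).factorial : ℂ)) * (R : ℂ) ^ (l.1 : ℕ) else 0)‖ :=
        norm_sum_le _ _
    _ ≤ ∑ j : Fin T₀, ‖x ^ (j : ℕ) / ((j : ℕ).factorial : ℂ)‖ * (Real.exp ρ * R ^ D₀) := by
        refine Finset.sum_le_sum fun j _ => ?_
        split_ifs
        · rw [norm_mul, norm_mul, mul_assoc]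
          refine mul_le_mul_of_nonneg_left ?_ (norm_nonneg _)
          exact mul_le_mul (norm_pow_div_factorial_le_exp hνρ _) hRa (norm_nonneg _)
            (Real.exp_pos _).le
        · rw [norm_zero]
          positivity
    _ = (∑ j : Fin T₀, ‖x ^ (j : ℕ) / ((j : ℕ).factorial : ℂ)‖) * (Real.exp ρ * R ^ D₀) := by
        rw [Finset.sum_mul]
    _ ≤ Real.exp ρ * (Real.exp ρ * R ^ D₀) :=
        mul_le_mul_of_nonneg_right (sum_norm_pow_div_factorial_le_exp hxρ _) (by positivity)
    _ = R ^ D₀ * Real.exp ρ ^ 2 := by ring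

/-- Distributing a product of two finite sums. [folklore] -/
theorem mul_sum_mul_sum_expand {ι₁ ι₂ : Type*} [Fintype ι₁] [Fintype ι₂] (c x : ℂ)
    (A : ι₁ → ℂ) (B : ι₂ → ℂ) :
    c * (x * (∑ j, A j) * (∑ i, B i)) = ∑ i, ∑ j, c * x * A j * B i := by
  calc c * (x * (∑ j, A j) * (∑ i, B i)) = (c * x) * ((∑ j, A j) * (∑ i, B i)) := by ring
    _ = (c * x) * ∑ j, ∑ i, A j * B i := by rw [Finset.sum_mul_sum]
    _ = ∑ j, ∑ i, (c * x) * (A j * B i) := by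
        rw [Finset.mul_sum]
        exact Finset.sum_congr rfl fun j _ => Finset.mul_sum _ _ _
    _ = ∑ i, ∑ j, c * x * A j * B i := by
        rw [Finset.sum_comm]
        exact Finset.sum_congr rfl fun i _ => Finset.sum_congr rfl fun j _ => by ring

/-- **The main term, regrouped by monomials.** For integers `p(a,b,c)`:
`∑ p(a,b,c) · w^a E_{T₀}(-bw) E_{T₀}(ν s) = ∑_{(i,e)} (∑ p(a,b,c) q_{(i,e),(a,b,c)}) w^e s^i`.
[folklore] -/
theorem main_identity (κ : ℂ) (p : Fin D₀ × Fin D₁ × Fin D₁ → ℤ) (s w : ℂ) :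
    ∑ l : Fin D₀ × Fin D₁ × Fin D₁, (p l : ℂ) * (w ^ (l.1 : ℕ) *
        (∑ j : Fin T₀, ((-(((l.2.1 : ℕ) : ℂ))) * w) ^ (j : ℕ) / ((j : ℕ).factorial : ℂ)) *
        (∑ i : Fin T₀, ((((l.2.1 : ℕ) : ℂ) + ((l.2.2 : ℕ) : ℂ) * κ) * s) ^ (i : ℕ) /
          ((i : ℕ).factorial : ℂ))) =
      ∑ r : Fin T₀ × Fin (T₀ + D₀), (∑ l : Fin D₀ × Fin D₁ × Fin D₁, (p l : ℂ) *
        (∑ j : Fin T₀, if ((r.2 : ℕ) = (l.1 : ℕ) + (j : ℕ)) then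
          ((-(((l.2.1 : ℕ) : ℂ))) ^ (j : ℕ) / ((j : ℕ).factorial : ℂ)) *
            ((((l.2.1 : ℕ) : ℂ) + ((l.2.2 : ℕ) : ℂ) * κ) ^ (r.1 : ℕ) / ((r.1 : ℕ).factorial : ℂ))
          else 0)) * w ^ (r.2 : ℕ) * s ^ (r.1 : ℕ) := by
  -- both sides equal the canonical triple sum `Q`
  set X : (Fin D₀ × Fin D₁ × Fin D₁) → Fin T₀ → Fin T₀ → ℂ := fun l j i =>
    ((-(((l.2.1 : ℕ) : ℂ))) ^ (j : ℕ) / ((j : ℕ).factorial : ℂ)) *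
      ((((l.2.1 : ℕ) : ℂ) + ((l.2.2 : ℕ) : ℂ) * κ) ^ (i : ℕ) / ((i : ℕ).factorial : ℂ)) with hX
  have hL : ∀ l : Fin D₀ × Fin D₁ × Fin D₁, (p l : ℂ) * (w ^ (l.1 : ℕ) *
        (∑ j : Fin T₀, ((-(((l.2.1 : ℕ) : ℂ))) * w) ^ (j : ℕ) / ((j : ℕ).factorial : ℂ)) *
        (∑ i : Fin T₀, ((((l.2.1 : ℕ) : ℂ) + ((l.2.2 : ℕ) : ℂ) * κ) * s) ^ (i : ℕ) /
          ((i : ℕ).factorial : ℂ))) =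
      ∑ i : Fin T₀, ∑ j : Fin T₀, (p l : ℂ) * X l j i * w ^ ((l.1 : ℕ) + (j : ℕ)) * s ^ (i : ℕ) := by
    intro l
    rw [mul_sum_mul_sum_expand]
    refine Finset.sum_congr rfl fun i _ => Finset.sum_congr rfl fun j _ => ?_
    rw [hX, mul_pow, mul_pow, pow_add]
    ring
  have hR : ∀ l : Fin D₀ × Fin D₁ × Fin D₁,
      ∑ r : Fin T₀ × Fin (T₀ + D₀), (p l : ℂ) *
        (∑ j : Fin T₀, if ((r.2 : ℕ) = (l.1 : ℕ) + (j : ℕ)) then X l j r.1 else 0) *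
          w ^ (r.2 : ℕ) * s ^ (r.1 : ℕ) =
      ∑ i : Fin T₀, ∑ j : Fin T₀, (p l : ℂ) * X l j i * w ^ ((l.1 : ℕ) + (j : ℕ)) * s ^ (i : ℕ) := by
    intro l
    rw [Fintype.sum_prod_type]
    refine Finset.sum_congr rfl fun i _ => ?_
    have h1 : ∀ e : Fin (T₀ + D₀), (p l : ℂ) *
        (∑ j : Fin T₀, if ((e : ℕ) = (l.1 : ℕ) + (j : ℕ)) then X l j i else 0) *
          w ^ (e : ℕ) * s ^ (i : ℕ) =
        ∑ j : Fin T₀, (if ((e : ℕ) = (l.1 : ℕ) + (j : ℕ)) then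
          (p l : ℂ) * X l j i * w ^ (e : ℕ) * s ^ (i : ℕ) else 0) := by
      intro e
      rw [Finset.mul_sum, Finset.sum_mul, Finset.sum_mul]
      refine Finset.sum_congr rfl fun j _ => ?_
      split_ifs <;> ring
    simp_rw [h1]
    rw [Finset.sum_comm]
    refine Finset.sum_congr rfl fun j _ => ?_
    have hlt : (l.1 : ℕ) + (j : ℕ) < T₀ + D₀ := by
      have := l.1.isLt; have := j.isLt; omega
    rw [sum_fin_ite_val_eq hlt]
  calc _ = ∑ l : Fin D₀ × Fin D₁ × Fin D₁, ∑ i : Fin T₀, ∑ j : Fin T₀,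
          (p l : ℂ) * X l j i * w ^ ((l.1 : ℕ) + (j : ℕ)) * s ^ (i : ℕ) :=
        Finset.sum_congr rfl fun l _ => hL l
    _ = ∑ l : Fin D₀ × Fin D₁ × Fin D₁, ∑ r : Fin T₀ × Fin (T₀ + D₀), (p l : ℂ) *
          (∑ j : Fin T₀, if ((r.2 : ℕ) = (l.1 : ℕ) + (j : ℕ)) then X l j r.1 else 0) *
            w ^ (r.2 : ℕ) * s ^ (r.1 : ℕ) :=
        Finset.sum_congr rfl fun l _ => (hR l).symm
    _ = _ := by
        rw [Finset.sum_comm]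
        refine Finset.sum_congr rfl fun r _ => ?_
        rw [Finset.sum_mul, Finset.sum_mul]

/-- **The tail.** For `R ≥ 1`, `a < D₀`, `bR ≤ ρ`, `|ν|R ≤ ρ`, `8ρ ≤ T₀`, `T₀ ≥ 1` and
`|s|, |w| ≤ R`:
`|w^a e^{-bw} e^{νs} − w^a E_{T₀}(-bw) E_{T₀}(νs)| ≤ R^{D₀} · 4e^{ρ}e^{-T₀}`. [folklore] -/
theorem norm_term_sub_trunc_le (κ : ℂ) {R ρ : ℝ} (hR : 1 ≤ R) {T₀ : ℕ} (hT : 8 * ρ ≤ T₀)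
    (hT1 : 1 ≤ T₀) (l : Fin D₀ × Fin D₁ × Fin D₁) (hb : ((l.2.1 : ℕ) : ℝ) * R ≤ ρ)
    (hν : ‖(((l.2.1 : ℕ) : ℂ) + ((l.2.2 : ℕ) : ℂ) * κ)‖ * R ≤ ρ) {s w : ℂ} (hs : ‖s‖ ≤ R)
    (hw : ‖w‖ ≤ R) :
    ‖w ^ (l.1 : ℕ) * cexp ((-(((l.2.1 : ℕ) : ℂ))) * w) *
        cexp ((((l.2.1 : ℕ) : ℂ) + ((l.2.2 : ℕ) : ℂ) * κ) * s) -
      w ^ (l.1 : ℕ) *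
        (∑ j : Fin T₀, ((-(((l.2.1 : ℕ) : ℂ))) * w) ^ (j : ℕ) / ((j : ℕ).factorial : ℂ)) *
        (∑ i : Fin T₀, ((((l.2.1 : ℕ) : ℂ) + ((l.2.2 : ℕ) : ℂ) * κ) * s) ^ (i : ℕ) /
          ((i : ℕ).factorial : ℂ))‖ ≤
      R ^ D₀ * (4 * Real.exp ρ * Real.exp (-T₀)) := by
  have hR0 : 0 ≤ R := zero_le_one.trans hR
  set x₁ : ℂ := (-(((l.2.1 : ℕ) : ℂ))) * w with hx₁
  set x₂ : ℂ := (((l.2.1 : ℕ) : ℂ) + ((l.2.2 : ℕ) : ℂ) * κ) * s with hx₂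
  set E₁ : ℂ := ∑ j : Fin T₀, x₁ ^ (j : ℕ) / ((j : ℕ).factorial : ℂ) with hE₁
  set E₂ : ℂ := ∑ i : Fin T₀, x₂ ^ (i : ℕ) / ((i : ℕ).factorial : ℂ) with hE₂
  have hx₁ρ : ‖x₁‖ ≤ ρ := by
    rw [hx₁, norm_mul, norm_neg, Complex.norm_natCast]
    exact (mul_le_mul_of_nonneg_left hw (Nat.cast_nonneg _)).trans hb
  have hx₂ρ : ‖x₂‖ ≤ ρ := by
    rw [hx₂, norm_mul]
    exact (mul_le_mul_of_nonneg_left hs (norm_nonneg _)).trans hν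
  have hρ0 : 0 ≤ ρ := (norm_nonneg _).trans hx₁ρ
  have hwa : ‖w ^ (l.1 : ℕ)‖ ≤ R ^ D₀ := by
    rw [norm_pow]
    exact (pow_le_pow_left₀ (norm_nonneg _) hw _).trans (pow_le_pow_right₀ hR l.1.isLt.le)
  have he₁ : ‖cexp x₁‖ ≤ Real.exp ρ :=
    (Complex.norm_exp_le_exp_norm _).trans (Real.exp_le_exp.mpr hx₁ρ)
  have hE₂ : ‖E₂‖ ≤ Real.exp ρ :=
    (norm_expPartialSum_le _ _).trans (Real.exp_le_exp.mpr hx₂ρ)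
  have hd₁ : ‖cexp x₁ - E₁‖ ≤ 2 * Real.exp (-T₀) := norm_exp_sub_partialSum_le hx₁ρ hT hT1
  have hd₂ : ‖cexp x₂ - E₂‖ ≤ 2 * Real.exp (-T₀) := norm_exp_sub_partialSum_le hx₂ρ hT hT1
  have hsplit : w ^ (l.1 : ℕ) * cexp x₁ * cexp x₂ - w ^ (l.1 : ℕ) * E₁ * E₂ =
      w ^ (l.1 : ℕ) * (cexp x₁ * (cexp x₂ - E₂) + (cexp x₁ - E₁) * E₂) := by ring
  rw [hsplit, norm_mul]
  refine mul_le_mul hwa ?_ (norm_nonneg _) (by positivity)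
  calc ‖cexp x₁ * (cexp x₂ - E₂) + (cexp x₁ - E₁) * E₂‖
      ≤ ‖cexp x₁‖ * ‖cexp x₂ - E₂‖ + ‖cexp x₁ - E₁‖ * ‖E₂‖ := by
        refine (norm_add_le _ _).trans ?_
        rw [norm_mul, norm_mul]
    _ ≤ Real.exp ρ * (2 * Real.exp (-T₀)) + 2 * Real.exp (-T₀) * Real.exp ρ :=
        add_le_add (mul_le_mul he₁ hd₂ (norm_nonneg _) (Real.exp_pos _).le)
          (mul_le_mul hd₁ hE₂ (norm_nonneg _) (by positivity))
    _ = 4 * Real.exp ρ * Real.exp (-T₀) := by ring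

/-- **The analytic half of Proposition 6.1** (for `𝔾ₐ × 𝔾ₘ²`, `V`, `W` as in part I). If every
truncated Taylor coefficient `∑_l p_l M_{r,l}` has modulus `≤ ε`, then for `|s|, |w| ≤ R`
(`R ≥ 1`, `D₁R ≤ ρ`, `D₁(1+|κ|)R ≤ ρ`, `8ρ ≤ T₀`, `|p_l| ≤ P_b`):
`|∑ p(a,b,c) w^a e^{-bw} e^{(b+cκ)s}| ≤ T₀(T₀+D₀) ε + D₀D₁² P_b R^{D₀} 4e^{ρ}e^{-T₀}`.
[cite: Waldschmidt1981, §3 Théorème 3.1 (the pattern)] -/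
theorem norm_F_le (κ : ℂ) {R ρ ε : ℝ} (hR : 1 ≤ R) {T₀ : ℕ} (hT : 8 * ρ ≤ T₀) (hT1 : 1 ≤ T₀)
    (hρ₁ : (D₁ : ℝ) * R ≤ ρ) (hρ₂ : ((D₁ : ℝ) + D₁ * ‖κ‖) * R ≤ ρ)
    (p : Fin D₀ × Fin D₁ × Fin D₁ → ℤ) {Pb : ℕ} (hp : ∀ l, |p l| ≤ Pb)
    (hε : ∀ r : Fin T₀ × Fin (T₀ + D₀),
      ‖∑ l : Fin D₀ × Fin D₁ × Fin D₁, (p l : ℂ) *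
        (∑ j : Fin T₀, if ((r.2 : ℕ) = (l.1 : ℕ) + (j : ℕ)) then
          ((-(((l.2.1 : ℕ) : ℂ)) * R) ^ (j : ℕ) / ((j : ℕ).factorial : ℂ)) *
            (((((l.2.1 : ℕ) : ℂ) + ((l.2.2 : ℕ) : ℂ) * κ) * R) ^ (r.1 : ℕ) /
              ((r.1 : ℕ).factorial : ℂ)) * (R : ℂ) ^ (l.1 : ℕ) else 0)‖ ≤ ε)
    {s w : ℂ} (hs : ‖s‖ ≤ R) (hw : ‖w‖ ≤ R) :
    ‖∑ l : Fin D₀ × Fin D₁ × Fin D₁, (p l : ℂ) * (w ^ (l.1 : ℕ) *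
        cexp ((-(((l.2.1 : ℕ) : ℂ))) * w) * cexp ((((l.2.1 : ℕ) : ℂ) + ((l.2.2 : ℕ) : ℂ) * κ) * s))‖ ≤
      (T₀ * (T₀ + D₀) : ℝ) * ε + (D₀ * (D₁ * D₁) : ℝ) * Pb * (R ^ D₀ * (4 * Real.exp ρ * Real.exp (-T₀))) := by
  have hR0 : 0 ≤ R := zero_le_one.trans hR
  -- the per-index bounds
  have hb : ∀ l : Fin D₀ × Fin D₁ × Fin D₁, ((l.2.1 : ℕ) : ℝ) * R ≤ ρ := fun l =>
    (mul_le_mul_of_nonneg_right (by exact_mod_cast l.2.1.isLt.le) hR0).trans hρ₁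
  have hν : ∀ l : Fin D₀ × Fin D₁ × Fin D₁,
      ‖(((l.2.1 : ℕ) : ℂ) + ((l.2.2 : ℕ) : ℂ) * κ)‖ * R ≤ ρ := fun l => by
    refine (mul_le_mul_of_nonneg_right ?_ hR0).trans hρ₂
    calc ‖(((l.2.1 : ℕ) : ℂ) + ((l.2.2 : ℕ) : ℂ) * κ)‖
        ≤ ‖((l.2.1 : ℕ) : ℂ)‖ + ‖((l.2.2 : ℕ) : ℂ) * κ‖ := norm_add_le _ _
      _ ≤ D₁ + D₁ * ‖κ‖ := by
          rw [norm_mul, Complex.norm_natCast, Complex.norm_natCast]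
          have h1 : ((l.2.1 : ℕ) : ℝ) ≤ D₁ := by exact_mod_cast l.2.1.isLt.le
          have h2 : ((l.2.2 : ℕ) : ℝ) ≤ D₁ := by exact_mod_cast l.2.2.isLt.le
          gcongr
  -- the truncations and the main term
  set trunc : (Fin D₀ × Fin D₁ × Fin D₁) → ℂ := fun l => w ^ (l.1 : ℕ) *
      (∑ j : Fin T₀, ((-(((l.2.1 : ℕ) : ℂ))) * w) ^ (j : ℕ) / ((j : ℕ).factorial : ℂ)) *
      (∑ i : Fin T₀, ((((l.2.1 : ℕ) : ℂ) + ((l.2.2 : ℕ) : ℂ) * κ) * s) ^ (i : ℕ) /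
        ((i : ℕ).factorial : ℂ)) with htrunc
  set term : (Fin D₀ × Fin D₁ × Fin D₁) → ℂ := fun l => w ^ (l.1 : ℕ) *
      cexp ((-(((l.2.1 : ℕ) : ℂ))) * w) * cexp ((((l.2.1 : ℕ) : ℂ) + ((l.2.2 : ℕ) : ℂ) * κ) * s)
    with hterm
  set q : (Fin T₀ × Fin (T₀ + D₀)) → (Fin D₀ × Fin D₁ × Fin D₁) → ℂ := fun r l =>
    ∑ j : Fin T₀, if ((r.2 : ℕ) = (l.1 : ℕ) + (j : ℕ)) then
      ((-(((l.2.1 : ℕ) : ℂ))) ^ (j : ℕ) / ((j : ℕ).factorial : ℂ)) *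
        ((((l.2.1 : ℕ) : ℂ) + ((l.2.2 : ℕ) : ℂ) * κ) ^ (r.1 : ℕ) / ((r.1 : ℕ).factorial : ℂ))
      else 0 with hq
  have hmain : ∑ l, (p l : ℂ) * trunc l =
      ∑ r : Fin T₀ × Fin (T₀ + D₀), (∑ l, (p l : ℂ) * q r l) * w ^ (r.2 : ℕ) * s ^ (r.1 : ℕ) :=
    main_identity κ p s w
  -- bound for the main term
  have hmain_le : ‖∑ l, (p l : ℂ) * trunc l‖ ≤ (T₀ * (T₀ + D₀) : ℝ) * ε := by
    rw [hmain]
    calc ‖∑ r : Fin T₀ × Fin (T₀ + D₀), (∑ l, (p l : ℂ) * q r l) * w ^ (r.2 : ℕ) * s ^ (r.1 : ℕ)‖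
        ≤ ∑ r : Fin T₀ × Fin (T₀ + D₀), ‖(∑ l, (p l : ℂ) * q r l) * w ^ (r.2 : ℕ) * s ^ (r.1 : ℕ)‖ :=
          norm_sum_le _ _
      _ ≤ ∑ _r : Fin T₀ × Fin (T₀ + D₀), ε := Finset.sum_le_sum fun r _ => by
          have hid : ∑ l, (p l : ℂ) * (q r l * (R : ℂ) ^ ((r.2 : ℕ) + (r.1 : ℕ))) =
              (∑ l, (p l : ℂ) * q r l) * (R : ℂ) ^ ((r.2 : ℕ) + (r.1 : ℕ)) := by
            rw [Finset.sum_mul]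
            exact Finset.sum_congr rfl fun l _ => by ring
          have hεr := hε r
          simp_rw [entry_eq_coeff_mul_pow κ R r] at hεr
          rw [hid] at hεr
          refine le_trans ?_ hεr
          rw [norm_mul, norm_mul, norm_mul, norm_pow, norm_pow, norm_pow, Complex.norm_real,
            Real.norm_eq_abs, abs_of_nonneg hR0, pow_add, mul_assoc]
          refine mul_le_mul_of_nonneg_left ?_ (norm_nonneg _)
          exact mul_le_mul (pow_le_pow_left₀ (norm_nonneg _) hw _)
            (pow_le_pow_left₀ (norm_nonneg _) hs _) (by positivity) (by positivity)
      _ = (T₀ * (T₀ + D₀) : ℝ) * ε := by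
          rw [Finset.sum_const, Finset.card_univ, Fintype.card_prod, Fintype.card_fin,
            Fintype.card_fin, nsmul_eq_mul]
          push_cast
          ring
  -- bound for the remainder
  have hrem_le : ‖∑ l, (p l : ℂ) * term l - ∑ l, (p l : ℂ) * trunc l‖ ≤
      (D₀ * (D₁ * D₁) : ℝ) * Pb * (R ^ D₀ * (4 * Real.exp ρ * Real.exp (-T₀))) := by
    rw [← Finset.sum_sub_distrib]
    calc ‖∑ l, ((p l : ℂ) * term l - (p l : ℂ) * trunc l)‖
        ≤ ∑ l, ‖(p l : ℂ) * term l - (p l : ℂ) * trunc l‖ := norm_sum_le _ _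
      _ ≤ ∑ _l : Fin D₀ × Fin D₁ × Fin D₁, (Pb : ℝ) * (R ^ D₀ * (4 * Real.exp ρ * Real.exp (-T₀))) :=
          Finset.sum_le_sum fun l _ => by
            rw [← mul_sub, norm_mul]
            refine mul_le_mul ?_ ?_ (norm_nonneg _) (Nat.cast_nonneg _)
            · rw [Complex.norm_intCast]; exact_mod_cast hp l
            · exact norm_term_sub_trunc_le κ hR hT hT1 l (hb l) (hν l) hs hw
      _ = (D₀ * (D₁ * D₁) : ℝ) * Pb * (R ^ D₀ * (4 * Real.exp ρ * Real.exp (-T₀))) := by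
          rw [Finset.sum_const, Finset.card_univ, Fintype.card_prod, Fintype.card_prod,
            Fintype.card_fin, Fintype.card_fin, nsmul_eq_mul]
          push_cast
          ring
  calc ‖∑ l, (p l : ℂ) * term l‖
      = ‖∑ l, (p l : ℂ) * trunc l + (∑ l, (p l : ℂ) * term l - ∑ l, (p l : ℂ) * trunc l)‖ := by
        congr 1; ring
    _ ≤ ‖∑ l, (p l : ℂ) * trunc l‖ + ‖∑ l, (p l : ℂ) * term l - ∑ l, (p l : ℂ) * trunc l‖ :=
        norm_add_le _ _
    _ ≤ _ := add_le_add hmain_le hrem_le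

/-- **Small values of the auxiliary function** (the box-principle form of Proposition 6.1 of
[Waldschmidt1988] for the configuration of Corollary 2.2). Let `R ≥ 1`, `D₁R ≤ ρ`,
`D₁(1+|κ|)R ≤ ρ`, `8ρ ≤ T₀`, `T₀ ≥ 1`, `k ≥ 1` with `k^{2T₀(T₀+D₀)} < (P_b+1)^{D₀D₁²}`. Then there
are integers `p(a,b,c)` (`a < D₀`, `b, c < D₁`), not all zero, `|p| ≤ P_b`, with
`|∑ p(a,b,c) w^a e^{-bw} e^{(b+cκ)s}| ≤ T₀(T₀+D₀)·2(2D₀D₁²R^{D₀}e^{2ρ}P_b + 1)/k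
 + D₀D₁²P_bR^{D₀}·4e^{ρ}e^{-T₀}` for all `|s|, |w| ≤ R`.
[cite: Waldschmidt1988, §6 Proposition 6.1 (pp. 388–389)]
[cite: Waldschmidt1981, §3 Théorème 3.1] -/
theorem exists_smallValues (κ : ℂ) {R ρ : ℝ} (hR : 1 ≤ R) {D₀ D₁ T₀ : ℕ} (Pb k : ℕ)
    (hT : 8 * ρ ≤ T₀) (hT1 : 1 ≤ T₀) (hρ₁ : (D₁ : ℝ) * R ≤ ρ)
    (hρ₂ : ((D₁ : ℝ) + D₁ * ‖κ‖) * R ≤ ρ) (hk : 0 < k)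
    (hcard : k ^ (2 * (T₀ * (T₀ + D₀))) < (Pb + 1) ^ (D₀ * (D₁ * D₁))) :
    ∃ p : Fin D₀ × Fin D₁ × Fin D₁ → ℤ, p ≠ 0 ∧ (∀ l, |p l| ≤ Pb) ∧
      ∀ s w : ℂ, ‖s‖ ≤ R → ‖w‖ ≤ R →
        ‖∑ l : Fin D₀ × Fin D₁ × Fin D₁, (p l : ℂ) * (w ^ (l.1 : ℕ) *
          cexp ((-(((l.2.1 : ℕ) : ℂ))) * w) *
            cexp ((((l.2.1 : ℕ) : ℂ) + ((l.2.2 : ℕ) : ℂ) * κ) * s))‖ ≤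
        (T₀ * (T₀ + D₀) : ℝ) *
            (2 * ((2 * (D₀ * (D₁ * D₁) : ℝ) * (R ^ D₀ * Real.exp ρ ^ 2) * Pb + 1) / k)) +
          (D₀ * (D₁ * D₁) : ℝ) * Pb * (R ^ D₀ * (4 * Real.exp ρ * Real.exp (-T₀))) := by
  have hR0 : 0 ≤ R := zero_le_one.trans hR
  have hb : ∀ l : Fin D₀ × Fin D₁ × Fin D₁, ((l.2.1 : ℕ) : ℝ) * R ≤ ρ := fun l =>
    (mul_le_mul_of_nonneg_right (by exact_mod_cast l.2.1.isLt.le) hR0).trans hρ₁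
  have hν : ∀ l : Fin D₀ × Fin D₁ × Fin D₁,
      ‖(((l.2.1 : ℕ) : ℂ) + ((l.2.2 : ℕ) : ℂ) * κ)‖ * R ≤ ρ := fun l => by
    refine (mul_le_mul_of_nonneg_right ?_ hR0).trans hρ₂
    calc ‖(((l.2.1 : ℕ) : ℂ) + ((l.2.2 : ℕ) : ℂ) * κ)‖
        ≤ ‖((l.2.1 : ℕ) : ℂ)‖ + ‖((l.2.2 : ℕ) : ℂ) * κ‖ := norm_add_le _ _
      _ ≤ D₁ + D₁ * ‖κ‖ := by
          rw [norm_mul, Complex.norm_natCast, Complex.norm_natCast]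
          have h1 : ((l.2.1 : ℕ) : ℝ) ≤ D₁ := by exact_mod_cast l.2.1.isLt.le
          have h2 : ((l.2.2 : ℕ) : ℝ) ≤ D₁ := by exact_mod_cast l.2.2.isLt.le
          gcongr
  set M : (Fin T₀ × Fin (T₀ + D₀)) → (Fin D₀ × Fin D₁ × Fin D₁) → ℂ := fun r l =>
    ∑ j : Fin T₀, if ((r.2 : ℕ) = (l.1 : ℕ) + (j : ℕ)) then
      ((-(((l.2.1 : ℕ) : ℂ)) * R) ^ (j : ℕ) / ((j : ℕ).factorial : ℂ)) *
        (((((l.2.1 : ℕ) : ℂ) + ((l.2.2 : ℕ) : ℂ) * κ) * R) ^ (r.1 : ℕ) /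
          ((r.1 : ℕ).factorial : ℂ)) * (R : ℂ) ^ (l.1 : ℕ) else 0 with hM
  have hMA : ∀ r l, ‖M r l‖ ≤ R ^ D₀ * Real.exp ρ ^ 2 := fun r l =>
    norm_entry_le κ hR r l (hb l) (hν l)
  have hcard' : k ^ (2 * Fintype.card (Fin T₀ × Fin (T₀ + D₀))) <
      (Pb + 1) ^ Fintype.card (Fin D₀ × Fin D₁ × Fin D₁) := by
    simpa only [Fintype.card_prod, Fintype.card_fin] using hcard
  obtain ⟨p, hp0, hpP, hpL⟩ := box_principle_complex M (by positivity) hMA Pb k hk hcard'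
  refine ⟨p, hp0, hpP, fun s w hs hw => ?_⟩
  have hcardΛ : (Fintype.card (Fin D₀ × Fin D₁ × Fin D₁) : ℝ) = (D₀ * (D₁ * D₁) : ℝ) := by
    simp only [Fintype.card_prod, Fintype.card_fin]
    push_cast
    ring
  rw [hcardΛ] at hpL
  exact norm_F_le κ hR hT hT1 hρ₁ hρ₂ p hpP hpL hs hw

end Coefficients

end Literature.NumberTheory.Transcendental.Waldschmidt1988
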